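import Literature.AnabelianGeometry.SemiGraphs.TemperedHbddOfConfinedGeodesics
import HarnessLib

/-!
# [SemiAnbd] Thm 3.7 (iii) / Cor 3.9 (R3c) at ANY valence: at the host vertex of a fixed branch over
# `b₀`, foreign base branches carry no fixed branch from some level on — the first (and last) step of an
# escape path is over `b₀` or over a branch type that occurs only finitely often

Mochizuki, *Semi-graphs of anabelioids*, Publ. RIMS **42** (2006), §2 Def. 2.4 (iv) p. 26 (totally
estranged) and §3, Theorem 3.7 (iii), proof p. 41 with the author's *Comments* (2020) (6)(b); Cor. 3.9,
proof p. 43 l. 13 (the cell's step (R3c), FACT-LIST rows F-2772 `EdgeLikeCentralizerAt` /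
F-2773 `EdgeLikeCentralizer`) [cite: MochizukiSemiAnbd2006, Thm 3.7(iii) p.41].

PROOF-ONLY (cell abc-iut, block F, seat abc-iut-f-172 gen 5; residual «infinite valence» of GAP row
G-t6g3-2b, memo HOME/staging/f/f-172/gen5/RETRACTION-STAR-F2773-memo.md §2 (S2), brick K2; no
definition, no named fact).  abc-iut-w6-d062's per-pair estrangement in depth
(`eventually_not_fixed_pair_of_ne_base_pair`, any valence, single element) read at the HOST VERTEX of an
edge piece: if at every level the vertex `x_j` of `𝔾̃_j` (over the base vertex `u`) carries a branch over
the base branch `b₀` whose edge is fixed by the subgroup `C ≠ 1` (e.g. `C` an open piece of the edge group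
of `b₀`, `x` the fixed system of its verticial host), then for every OTHER base branch `b₁ ≠ b₀` at `u`
there is a level from which on NO branch at `x_j` over `b₁` has a `C`-fixed edge
(`eventually_no_fixed_branch_over_ne_at_host`).  Consequently (`eventually_firstBranch_not_over`) for
every compatible `C`-fixed vertex system `x'` the geodesic `[x_j, x'_j]` eventually does not START over
`b₁`; and for `x' = g·x` with `g` centralising `C` it eventually does not END over `b₁` either
(`eventually_lastBranch_not_over_of_centralizer`: `g·x_j` carries the `C`-fixed branch `g·δ_j` over
`b₀`).  At a vertex `u` of FINITE valence this pins the first/last step of any escape to the type `b₀`;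
at INFINITE valence it leaves «`b₀`, or types each used finitely often» (the memo's drift case (II-b)).

Honest framing: the ∀-closures F-2773 / F-1732 are NOT claimed; nothing here bears on [IUTchIII]
Cor. 3.12; typed ≠ proved elsewhere.
-/

namespace Literature.AnabelianGeometry.SemiGraphs

namespace ProfiniteSemiGraph

open CategoryTheory Topology

universe u

variable (𝒢 : ProfiniteSemiGraph.{u}) (h37 : 𝒢.Thm37Hypotheses)

/-- **No fixed foreign branch at the host vertex, eventually** (any valence).  At the canonical tower of a
countable `𝒢` satisfying the hypotheses of Thm. 3.7, let `C ≠ 1` be a subgroup of `π₁^temp(𝒢)`, `u` a base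
vertex, `b₀ ≠ b₁` two branches of `𝔾` at `u`, and `x_j` vertices of `𝔾̃_j` over `u` each carrying a branch
over `b₀` whose edge is `C`-fixed.  Then from some level on, no branch at `x_j` over `b₁` has a `C`-fixed
edge (abc-iut-w6-d062's `eventually_not_fixed_pair_of_ne_base_pair` at the pair `(b₀, b₁)`).
[cite: MochizukiSemiAnbd2006, Thm 3.7(iii) p.41] -/
theorem eventually_no_fixed_branch_over_ne_at_host
    (C : Subgroup (𝒢.temperedPiChart h37.toProp36Hypotheses).G) (hC : C ≠ ⊥)
    (u : 𝒢.graph.Vertex) {b₀ b₁ : 𝒢.graph.Branch} (hb₀ : 𝒢.graph.abuts b₀ = some u)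
    (hb₁ : 𝒢.graph.abuts b₁ = some u) (hne : b₀ ≠ b₁)
    (x : ∀ j, ((𝒢.galoisLevelData h37.toProp36Hypotheses).tree j).Vertex)
    (hxu : ∀ j, ((𝒢.galoisLevelData h37.toProp36Hypotheses).treeProj j).vertexMap (x j) = u)
    (hδ : ∀ j, ∃ δ : ((𝒢.galoisLevelData h37.toProp36Hypotheses).tree j).Branch,
      ((𝒢.galoisLevelData h37.toProp36Hypotheses).tree j).abuts δ = some (x j) ∧
      ((𝒢.galoisLevelData h37.toProp36Hypotheses).treeProj j).branchMap δ = b₀ ∧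
      ∀ g ∈ C, ((𝒢.galoisLevelData h37.toProp36Hypotheses).treeAct h37.toProp36Hypotheses.isCountable j g).hom.edgeMap
          (((𝒢.galoisLevelData h37.toProp36Hypotheses).tree j).edgeOf δ) =
        ((𝒢.galoisLevelData h37.toProp36Hypotheses).tree j).edgeOf δ) :
    ∃ k : ℕ, ∀ j, k ≤ j → ∀ β : ((𝒢.galoisLevelData h37.toProp36Hypotheses).tree j).Branch,
      ((𝒢.galoisLevelData h37.toProp36Hypotheses).tree j).abuts β = some (x j) →
      ((𝒢.galoisLevelData h37.toProp36Hypotheses).treeProj j).branchMap β = b₁ →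
      (∀ g ∈ C, ((𝒢.galoisLevelData h37.toProp36Hypotheses).treeAct h37.toProp36Hypotheses.isCountable j g).hom.edgeMap
          (((𝒢.galoisLevelData h37.toProp36Hypotheses).tree j).edgeOf β) =
        ((𝒢.galoisLevelData h37.toProp36Hypotheses).tree j).edgeOf β) → False := by
  classical
  -- a non-trivial element of `C`, non-trivial at some level `j₀`
  obtain ⟨c, hcC, hc1⟩ : ∃ c ∈ C, c ≠ 1 := by
    by_contra h
    push Not at h
    exact hC ((Subgroup.eq_bot_iff_forall C).2 h)
  obtain ⟨j₀, hc⟩ := 𝒢.exists_proj_ne_one h37.toProp36Hypotheses c hc1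
  obtain ⟨k, -, hk⟩ := 𝒢.eventually_not_fixed_pair_of_ne_base_pair h37 c j₀ hc u hb₀ hb₁ hne
  refine ⟨k, fun j hj β hβ hβb hβfix => ?_⟩
  obtain ⟨δ, hδx, hδb, hδfix⟩ := hδ j
  -- a point sequence over `u` through `x j`
  obtain ⟨P, hPv⟩ : ∃ P : (𝒢.galoisLevelData h37.toProp36Hypotheses).PointSeq h37.toProp36Hypotheses.isCountable u,
      P.vertex j = x j := by
    have h := exists_pointSeq_vertex_eq_galoisLevelData h37.toProp36Hypotheses j (x j)
    rw [hxu j] at h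
    exact h
  rw [← hPv] at hδx hβ
  exact hk j hj P δ β hδb hβb hδx hβ (hδfix c hcC) (hβfix c hcC)

/-- A node on a path of the subdivision between two vertex-points fixed by every element of `C` is fixed
by every element of `C` (Lemma 1.8 (ii)(b), `SemiGraph.nodeMap_eq_self_of_isPath`); for a branch-point
this fixes its edge. [cite: MochizukiSemiAnbd2006, Lem. 1.8(ii)(b) p.20] -/
theorem edgeMap_edgeOf_eq_of_mem_support_of_fixed
    (C : Subgroup (𝒢.temperedPiChart h37.toProp36Hypotheses).G) (j : ℕ)
    {a a' : ((𝒢.galoisLevelData h37.toProp36Hypotheses).tree j).Vertex}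
    (ha : ∀ g ∈ C, ((𝒢.galoisLevelData h37.toProp36Hypotheses).treeAct h37.toProp36Hypotheses.isCountable j g).hom.vertexMap a = a)
    (ha' : ∀ g ∈ C, ((𝒢.galoisLevelData h37.toProp36Hypotheses).treeAct h37.toProp36Hypotheses.isCountable j g).hom.vertexMap a' = a')
    (p : ((𝒢.galoisLevelData h37.toProp36Hypotheses).tree j).subdivision.Walk (Sum.inl a) (Sum.inl a'))
    (hp : p.IsPath) {β : ((𝒢.galoisLevelData h37.toProp36Hypotheses).tree j).Branch}
    (hβ : (Sum.inr (Sum.inr β) : ((𝒢.galoisLevelData h37.toProp36Hypotheses).tree j).Node) ∈ p.support) :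
    ∀ g ∈ C, ((𝒢.galoisLevelData h37.toProp36Hypotheses).treeAct h37.toProp36Hypotheses.isCountable j g).hom.edgeMap
        (((𝒢.galoisLevelData h37.toProp36Hypotheses).tree j).edgeOf β) =
      ((𝒢.galoisLevelData h37.toProp36Hypotheses).tree j).edgeOf β := by
  intro g hg
  have hT := ((𝒢.galoisLevelData h37.toProp36Hypotheses).isTree_tree j).isTree
  have hxn : SemiGraph.nodeMap
      ((𝒢.galoisLevelData h37.toProp36Hypotheses).treeAct h37.toProp36Hypotheses.isCountable j g) (Sum.inl a) =
        Sum.inl a := by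
    simp [ha g hg]
  have hx'n : SemiGraph.nodeMap
      ((𝒢.galoisLevelData h37.toProp36Hypotheses).treeAct h37.toProp36Hypotheses.isCountable j g) (Sum.inl a') =
        Sum.inl a' := by
    simp [ha' g hg]
  have h := SemiGraph.nodeMap_eq_self_of_isPath hT.isAcyclic _ hxn hx'n p hp _ hβ
  simp only [SemiGraph.nodeMap_inr_inr, Sum.inr.injEq] at h
  rw [← ((𝒢.galoisLevelData h37.toProp36Hypotheses).treeAct h37.toProp36Hypotheses.isCountable j g).hom.edgeOf_branchMap β,
    h]

/-- **The escape path of a fixed pair does not START over a foreign base branch, eventually** (any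
valence): with `C`, `u`, `b₀ ≠ b₁`, `x`, the `C`-fixed branches over `b₀` at `x_j` as in
`eventually_no_fixed_branch_over_ne_at_host`, and `x` itself `C`-fixed, let `x'` be any vertices of the
`𝔾̃_j` fixed by `C`; then from some level on no branch at `x_j` lying on a path `[x_j, x'_j]` of `𝔾̃_j` is
over `b₁`. [cite: MochizukiSemiAnbd2006, Thm 3.7(iii) p.41] -/
theorem eventually_firstBranch_not_over
    (C : Subgroup (𝒢.temperedPiChart h37.toProp36Hypotheses).G) (hC : C ≠ ⊥)
    (u : 𝒢.graph.Vertex) {b₀ b₁ : 𝒢.graph.Branch} (hb₀ : 𝒢.graph.abuts b₀ = some u)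
    (hb₁ : 𝒢.graph.abuts b₁ = some u) (hne : b₀ ≠ b₁)
    (x x' : ∀ j, ((𝒢.galoisLevelData h37.toProp36Hypotheses).tree j).Vertex)
    (hxu : ∀ j, ((𝒢.galoisLevelData h37.toProp36Hypotheses).treeProj j).vertexMap (x j) = u)
    (hδ : ∀ j, ∃ δ : ((𝒢.galoisLevelData h37.toProp36Hypotheses).tree j).Branch,
      ((𝒢.galoisLevelData h37.toProp36Hypotheses).tree j).abuts δ = some (x j) ∧
      ((𝒢.galoisLevelData h37.toProp36Hypotheses).treeProj j).branchMap δ = b₀ ∧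
      ∀ g ∈ C, ((𝒢.galoisLevelData h37.toProp36Hypotheses).treeAct h37.toProp36Hypotheses.isCountable j g).hom.edgeMap
          (((𝒢.galoisLevelData h37.toProp36Hypotheses).tree j).edgeOf δ) =
        ((𝒢.galoisLevelData h37.toProp36Hypotheses).tree j).edgeOf δ)
    (hfx : ∀ g ∈ C, ∀ j, ((𝒢.galoisLevelData h37.toProp36Hypotheses).treeAct h37.toProp36Hypotheses.isCountable j g).hom.vertexMap (x j) = x j)
    (hfx' : ∀ g ∈ C, ∀ j, ((𝒢.galoisLevelData h37.toProp36Hypotheses).treeAct h37.toProp36Hypotheses.isCountable j g).hom.vertexMap (x' j) = x' j) :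
    ∃ k : ℕ, ∀ j, k ≤ j →
      ∀ (p : ((𝒢.galoisLevelData h37.toProp36Hypotheses).tree j).subdivision.Walk (Sum.inl (x j)) (Sum.inl (x' j))),
      p.IsPath → ∀ β : ((𝒢.galoisLevelData h37.toProp36Hypotheses).tree j).Branch,
      (Sum.inr (Sum.inr β) : ((𝒢.galoisLevelData h37.toProp36Hypotheses).tree j).Node) ∈ p.support →
      ((𝒢.galoisLevelData h37.toProp36Hypotheses).tree j).abuts β = some (x j) →
      ((𝒢.galoisLevelData h37.toProp36Hypotheses).treeProj j).branchMap β ≠ b₁ := by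
  obtain ⟨k, hk⟩ := 𝒢.eventually_no_fixed_branch_over_ne_at_host h37 C hC u hb₀ hb₁ hne x hxu hδ
  refine ⟨k, fun j hj p hp β hβp hβx hβb => hk j hj β hβx hβb ?_⟩
  exact 𝒢.edgeMap_edgeOf_eq_of_mem_support_of_fixed h37 C j (hfx · · j) (hfx' · · j) p hp hβp

/-- **Nor does it END over a foreign base branch, for a centralising translate** (any valence): if moreover
`x' = g·x` for an element `g` commuting with `C`, then `g·x_j` lies over `u` and carries the `C`-fixed branch
`g·δ_j` over `b₀`, so from some level on no branch at `g·x_j` lying on a path `[x_j, g·x_j]` is over `b₁`.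
[cite: MochizukiSemiAnbd2006, Cor 3.9 p.43] -/
theorem eventually_lastBranch_not_over_of_centralizer
    (C : Subgroup (𝒢.temperedPiChart h37.toProp36Hypotheses).G) (hC : C ≠ ⊥)
    (u : 𝒢.graph.Vertex) {b₀ b₁ : 𝒢.graph.Branch} (hb₀ : 𝒢.graph.abuts b₀ = some u)
    (hb₁ : 𝒢.graph.abuts b₁ = some u) (hne : b₀ ≠ b₁)
    (x : ∀ j, ((𝒢.galoisLevelData h37.toProp36Hypotheses).tree j).Vertex)
    (hxu : ∀ j, ((𝒢.galoisLevelData h37.toProp36Hypotheses).treeProj j).vertexMap (x j) = u)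
    (hδ : ∀ j, ∃ δ : ((𝒢.galoisLevelData h37.toProp36Hypotheses).tree j).Branch,
      ((𝒢.galoisLevelData h37.toProp36Hypotheses).tree j).abuts δ = some (x j) ∧
      ((𝒢.galoisLevelData h37.toProp36Hypotheses).treeProj j).branchMap δ = b₀ ∧
      ∀ g ∈ C, ((𝒢.galoisLevelData h37.toProp36Hypotheses).treeAct h37.toProp36Hypotheses.isCountable j g).hom.edgeMap
          (((𝒢.galoisLevelData h37.toProp36Hypotheses).tree j).edgeOf δ) =
        ((𝒢.galoisLevelData h37.toProp36Hypotheses).tree j).edgeOf δ)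
    (hfx : ∀ g ∈ C, ∀ j, ((𝒢.galoisLevelData h37.toProp36Hypotheses).treeAct h37.toProp36Hypotheses.isCountable j g).hom.vertexMap (x j) = x j)
    (g : (𝒢.temperedPiChart h37.toProp36Hypotheses).G) (hcomm : ∀ k ∈ C, k * g = g * k) :
    ∃ k : ℕ, ∀ j, k ≤ j →
      ∀ (p : ((𝒢.galoisLevelData h37.toProp36Hypotheses).tree j).subdivision.Walk (Sum.inl (x j))
        (Sum.inl (((𝒢.galoisLevelData h37.toProp36Hypotheses).treeAct h37.toProp36Hypotheses.isCountable j g).hom.vertexMap (x j)))),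
      p.IsPath → ∀ β : ((𝒢.galoisLevelData h37.toProp36Hypotheses).tree j).Branch,
      (Sum.inr (Sum.inr β) : ((𝒢.galoisLevelData h37.toProp36Hypotheses).tree j).Node) ∈ p.support →
      ((𝒢.galoisLevelData h37.toProp36Hypotheses).tree j).abuts β =
        some (((𝒢.galoisLevelData h37.toProp36Hypotheses).treeAct h37.toProp36Hypotheses.isCountable j g).hom.vertexMap (x j)) →
      ((𝒢.galoisLevelData h37.toProp36Hypotheses).treeProj j).branchMap β ≠ b₁ := by
  let D := 𝒢.galoisLevelData h37.toProp36Hypotheses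
  let hc := h37.toProp36Hypotheses.isCountable
  -- products act by composition
  have hmulV : ∀ (j : ℕ) (a b : (𝒢.temperedPiChart h37.toProp36Hypotheses).G) (v : (D.tree j).Vertex),
      (D.treeAct hc j (a * b)).hom.vertexMap v = (D.treeAct hc j a).hom.vertexMap ((D.treeAct hc j b).hom.vertexMap v) :=
    fun j a b v => by
      rw [show D.treeAct hc j (a * b) = D.treeAct hc j a * D.treeAct hc j b from map_mul (D.treeAct hc j) a b]
      rfl
  have hmulE : ∀ (j : ℕ) (a b : (𝒢.temperedPiChart h37.toProp36Hypotheses).G) (η : (D.tree j).Edge),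
      (D.treeAct hc j (a * b)).hom.edgeMap η = (D.treeAct hc j a).hom.edgeMap ((D.treeAct hc j b).hom.edgeMap η) :=
    fun j a b η => by
      rw [show D.treeAct hc j (a * b) = D.treeAct hc j a * D.treeAct hc j b from map_mul (D.treeAct hc j) a b]
      rfl
  -- the translate `g·x`: over `u`, `C`-fixed, carrying the `C`-fixed branch `g·δ` over `b₀`
  let y : ∀ j, (D.tree j).Vertex := fun j => (D.treeAct hc j g).hom.vertexMap (x j)
  have hyu : ∀ j, (D.treeProj j).vertexMap (y j) = u := by
    intro j
    have h := congrArg (fun φ => SemiGraph.Hom.vertexMap φ (x j)) (D.treeAct_over hc j g)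
    simp only [SemiGraph.comp_vertexMap, Function.comp_apply] at h
    rw [← hxu j]; exact h
  have hfy : ∀ k ∈ C, ∀ j, (D.treeAct hc j k).hom.vertexMap (y j) = y j := by
    intro k hk j
    change (D.treeAct hc j k).hom.vertexMap ((D.treeAct hc j g).hom.vertexMap (x j)) =
      (D.treeAct hc j g).hom.vertexMap (x j)
    rw [← hmulV, hcomm k hk, hmulV, hfx k hk j]
  have hδy : ∀ j, ∃ δ : (D.tree j).Branch, (D.tree j).abuts δ = some (y j) ∧ (D.treeProj j).branchMap δ = b₀ ∧
      ∀ k ∈ C, (D.treeAct hc j k).hom.edgeMap ((D.tree j).edgeOf δ) = (D.tree j).edgeOf δ := by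
    intro j
    obtain ⟨δ, hδx, hδb, hδfix⟩ := hδ j
    refine ⟨(D.treeAct hc j g).hom.branchMap δ, (D.treeAct hc j g).hom.abuts_branchMap δ _ hδx, ?_, fun k hk => ?_⟩
    · have h := congrArg (fun φ => SemiGraph.Hom.branchMap φ δ) (D.treeAct_over hc j g)
      simp only [SemiGraph.comp_branchMap, Function.comp_apply] at h
      rw [h, hδb]
    · rw [(D.treeAct hc j g).hom.edgeOf_branchMap δ, ← hmulE, hcomm k hk, hmulE, hδfix k hk]
  obtain ⟨k, hk⟩ := 𝒢.eventually_no_fixed_branch_over_ne_at_host h37 C hC u hb₀ hb₁ hne y hyu hδy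
  refine ⟨k, fun j hj p hp β hβp hβy hβb => hk j hj β hβy hβb ?_⟩
  exact 𝒢.edgeMap_edgeOf_eq_of_mem_support_of_fixed h37 C j (hfx · · j) (hfy · · j) p hp hβp

end ProfiniteSemiGraph

end Literature.AnabelianGeometry.SemiGraphs
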